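import Literature.RingTheory.MvPolynomial.KaltofenTestDefs
import Literature.NumberTheory.DiophantineGeometry.BertiniNewtonProofs
import HarnessLib

/-!
# Kaltofen's absolute irreducibility test, I: the scaled Newton identity and the root

Proofs about the objects of `KaltofenTestDefs` (E. Kaltofen, *Effective Noether irreducibility
forms and applications*, J. Comput. System Sci. 50 (1995) 274–295, §2 Step N, §3 Thm. 1):

* `cof_mul_derivative`: the Euclidean scheme `r · P₀'(z̄) = ρ` in `R = A[z]/(P(z,0))` (eq. (12)),
  from Mathlib's `sylveserMap_comp_adjSylvester`;
* `tildeP_eq`: **the scaled Newton identity** `P(z̄ + ρu, ρ²Y) = ρ P₀'(z̄) · F♮(u, Y)` in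
  `R[Y][u]`, `F♮ = u + r G` — Taylor expansion in `x` at `z̄` (Mathlib `taylor`, `hasseDeriv`)
  followed by the scalings; this is the division-free form of Kaltofen's normalisation
  `ā_k = ρ^{2k-1} a_k ∈ D[z]/(f₀)` (eq. (18)), which here holds by construction;
* `newtonSeq_spec`: the explicit Newton iterates of a `χ` with `χ(0) ≡ 0`, `χ'(0) ≡ 1 (mod Y)`
  are `≡ 0 (mod Y)` and roots to precision `Y^{k+1}` (tree: `newton_step`), and are functorial
  (`map_newtonSeq`);
* `deltaBar_spec`, `X_pow_dvd_eval_sharpP_alphaSharp`: `δ̄_K` is a root of `F♮` to precision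
  `Y^{K+1}`, hence `P(z̄ + ρδ̄_K, ρ²Y) ≡ 0 (mod Y^{K+1})` in `R[Y]` — over ANY coefficient ring.

No definitions, no named facts.

## References

* E. Kaltofen, J. Comput. System Sci. 50 (1995) 274–295, §2 Step N, §3 Thm. 1. [Kaltofen1995]
-/

noncomputable section

open Polynomial

namespace Literature.RingTheory.MvPolynomial.KaltofenAIT

universe u v

variable {A : Type u} [CommRing A]

/-! ### The Euclidean scheme `r · P₀'(z̄) = ρ` -/

/-- **The Euclidean scheme in `R`:** `r · P₀'(z̄) = ρ`. [cite: Kaltofen1995, §2 eq. (12)] -/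
theorem cof_mul_derivative {P : Polynomial A[X]} {d : ℕ} (hd : d ≠ 0)
    (hP : (red P).natDegree ≤ d) :
    cof P d * AdjoinRoot.mk (red P) (derivative (red P)) =
      algebraMap A (Rt P) (rres P d) := by
  have hP' : (derivative (red P)).natDegree ≤ d - 1 :=
    (natDegree_derivative_le _).trans (Nat.sub_le_sub_right hP 1)
  set x : degreeLT A (d + (d - 1)) := ⟨1, one_mem_degreeLT hd⟩ with hx
  set Y := adjSylvester (m := d) (n := d - 1) (red P) (derivative (red P)) x with hY
  have h1 : ((sylvesterMap (red P) (derivative (red P)) hP hP' Y)).1 =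
      ((rres P d • LinearMap.id (R := A) (M := degreeLT A (d + (d - 1)))) x).1 :=
    congrArg (fun φ : degreeLT A (d + (d - 1)) →ₗ[A] degreeLT A (d + (d - 1)) => (φ x).1)
      (sylveserMap_comp_adjSylvester (red P) (derivative (red P)) hP hP')
  simp only [sylvesterMap_apply_coe] at h1
  have h1' : red P * Y.2 + derivative (red P) * Y.1 = C (rres P d) := by
    rw [h1]
    simp [smul_eq_C_mul, hx]
  -- `P₀ * Y.2 + P₀' * Y.1 = C ρ` in `A[x]`; reduce modulo `P₀`
  have h2 : cofPoly P d = (Y.1 : A[X]) := by rw [cofPoly, dif_neg hd]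
  have h3 := congrArg (AdjoinRoot.mk (red P)) h1'
  rw [map_add, map_mul, map_mul, AdjoinRoot.mk_self, zero_mul, zero_add, AdjoinRoot.mk_C] at h3
  rw [cof, h2, mul_comm, h3, AdjoinRoot.algebraMap_eq]

/-! ### Generalities on polynomials -/

/-- Hasse derivatives commute with ring maps on coefficients. [folklore] -/
theorem hasseDeriv_map {R S : Type*} [Semiring R] [Semiring S] (f : R →+* S) (p : R[X]) (k : ℕ) :
    hasseDeriv k (p.map f) = (hasseDeriv k p).map f := by
  ext n
  simp only [hasseDeriv_coeff, coeff_map, map_mul, map_natCast]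

/-- Taylor's formula as a composition identity: `Q ∘ B = (taylor_c Q) ∘ (B - c)`. [folklore] -/
theorem comp_eq_taylor_comp {R : Type*} [CommRing R] (Q B : R[X]) (c : R) :
    Q.comp B = (taylor c Q).comp (B - C c) := by
  conv_lhs => rw [← sum_taylor_eq Q c]
  rw [← comp_eq_sum_left, comp_assoc, sub_comp, X_comp, C_comp]

/-- `Q(aX) = Σᵢ Qᵢ aⁱ Xⁱ`. [folklore] -/
theorem comp_C_mul_X_eq_sum {R : Type*} [CommSemiring R] (Q : R[X]) (a : R) {n : ℕ}
    (hn : Q.natDegree < n) :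
    Q.comp (C a * X) = ∑ i ∈ Finset.range n, C (Q.coeff i * a ^ i) * X ^ i := by
  conv_lhs => rw [as_sum_range' Q n hn, ← coe_compRingHom_apply, map_sum]
  refine Finset.sum_congr rfl fun i _ => ?_
  rw [coe_compRingHom_apply, monomial_comp, mul_pow, ← C_pow, ← mul_assoc, ← map_mul]

/-- Degree in `y` of `Q(c, y)` for `Q ∈ B[y][x]` and a constant `c`. [folklore] -/
theorem natDegree_eval_C_le {B : Type*} [CommSemiring B] (Q : Polynomial B[X]) (c : B) {e : ℕ}
    (hQ : ∀ k, (Q.coeff k).natDegree ≤ e) : (Q.eval (C c)).natDegree ≤ e := by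
  rw [eval_eq_sum_range]
  refine (natDegree_sum_le _ _).trans (Finset.sup_le fun k _ => ?_)
  -- each summand `Q_k * (C c)^k`
  change ((fun k => (Q.coeff k * C c ^ k).natDegree) k) ≤ e
  dsimp only
  rw [← C_pow]
  exact (natDegree_mul_C_le _ _).trans (hQ k)

/-! ### The Taylor data of `P` at `z̄` and the scaled Newton identity -/

section Taylor

variable {P : Polynomial A[X]} {d e : ℕ}

/-- `red (liftR P) = (red P)` read in `R`. [folklore] -/
theorem liftR_map_evalRingHom_zero :
    (liftR P).map (evalRingHom 0) = (red P).map (algebraMap A (Rt P)) := by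
  rw [Polynomial.map_map, Polynomial.map_map]
  congr 1
  ext p
  · simp
  · simp

/-- `T_0(0) = P(z̄, 0) = 0`. [folklore] -/
theorem tayl_zero_coeff_zero : (tayl P 0).coeff 0 = 0 := by
  rw [tayl, hasseDeriv_zero', Literature.NumberTheory.DiophantineGeometry.coeff_zero_eval_C,
    liftR_map_evalRingHom_zero, eval_map, AdjoinRoot.algebraMap_eq, AdjoinRoot.eval₂_root]

/-- `T_1(0) = ∂P/∂x (z̄, 0) = P₀'(z̄)`. [folklore] -/
theorem tayl_one_coeff_zero : (tayl P 1).coeff 0 = der0 P := by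
  rw [tayl, hasseDeriv_one', Literature.NumberTheory.DiophantineGeometry.coeff_zero_eval_C,
    ← derivative_map, liftR_map_evalRingHom_zero, derivative_map, eval_map, ← aeval_def,
    AdjoinRoot.aeval_eq]

/-- `T_i = 0` for `i > deg_x P`. [folklore] -/
theorem tayl_eq_zero_of_lt {i : ℕ} (hi : P.natDegree < i) : tayl P i = 0 := by
  rw [tayl, hasseDeriv_eq_zero_of_lt_natDegree _ _ (natDegree_map_le.trans_lt hi), eval_zero]

/-- `deg_y T_i ≤ e` when all `x`-coefficients of `P` have `y`-degree `≤ e`. [folklore] -/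
theorem natDegree_tayl_le (hPe : ∀ k, (P.coeff k).natDegree ≤ e) (i : ℕ) :
    (tayl P i).natDegree ≤ e := by
  refine natDegree_eval_C_le _ _ fun k => ?_
  rw [hasseDeriv_coeff, coeff_map]
  refine (natDegree_mul_le).trans ?_
  rw [show ((k + i).choose i : (Rt P)[X]) = C (((k + i).choose i : Rt P)) by simp, natDegree_C,
    zero_add]
  exact natDegree_map_le.trans (hPe _)

/-- The `y`-scaling fixes constants. [folklore] -/
theorem scaleY_C (c : Rt P) : scaleY P d (C c) = C c := by
  rw [coe_compRingHom_apply, C_comp]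

/-- **The scaled Newton identity** `P(z̄ + ρu, ρ²Y) = ρ P₀'(z̄) · F♮(u, Y)` in `R[Y][u]`
(for `deg_x P ≤ d`, `d ≥ 1`, `deg_y ≤ e`): the heart of the division-free normalisation of
Kaltofen's Newton iteration (`y = ρ²Y`, `x = z̄ + ρu`, `r P₀'(z̄) = ρ`).
[cite: Kaltofen1995, §3 Thm. 1 (eq. (18): `ρ^{2k-1} a_k ∈ D[z]/(f₀(z))`)] -/
theorem tildeP_eq (hd : d ≠ 0) (hP : P.natDegree ≤ d) (hPe : ∀ k, (P.coeff k).natDegree ≤ e) :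
    tildeP P d = C (C (rhoR P d * der0 P)) * natF P d e := by
  -- Taylor expansion in `x` at `z̄`, then the scaling `u ↦ ρ u`
  have hdeg : (taylor (C (zbar P)) (sharpP P d)).natDegree < d + 1 := by
    rw [natDegree_taylor, sharpP]
    exact (natDegree_map_le.trans (natDegree_map_le.trans hP)).trans_lt (Nat.lt_succ_self d)
  have h1 : tildeP P d = ∑ i ∈ Finset.range (d + 1),
      C ((taylor (C (zbar P)) (sharpP P d)).coeff i * C (rhoR P d) ^ i) * X ^ i := by
    rw [tildeP, comp_eq_taylor_comp _ _ (C (zbar P)), add_sub_cancel_left]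
    exact comp_C_mul_X_eq_sum _ _ hdeg
  -- the Taylor coefficients are the scaled `T_i`
  have h2 : ∀ i, (taylor (C (zbar P)) (sharpP P d)).coeff i = scaleY P d (tayl P i) := by
    intro i
    rw [taylor_coeff, sharpP, hasseDeriv_map, eval_map, ← scaleY_C (P := P) (d := d) (zbar P),
      eval₂_hom, tayl]
  have h3 : ∀ i, scaleY P d (tayl P i) = ∑ j ∈ Finset.range (e + 1),
      C ((tayl P i).coeff j * (rhoR P d ^ 2) ^ j) * X ^ j := fun i =>
    comp_C_mul_X_eq_sum _ _ ((natDegree_tayl_le hPe i).trans_lt (Nat.lt_succ_self e))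
  -- expand everything into the double sum of monomials `F_{j,i} ρ^{i+2j} Yʲ uⁱ`
  have h4 : tildeP P d = ∑ i ∈ Finset.range (d + 1), ∑ j ∈ Finset.range (e + 1),
      C (C ((tayl P i).coeff j * rhoR P d ^ (i + 2 * j)) * X ^ j) * X ^ i := by
    rw [h1]
    refine Finset.sum_congr rfl fun i _ => ?_
    rw [h2, h3, Finset.sum_mul, map_sum, Finset.sum_mul]
    refine Finset.sum_congr rfl fun j _ => ?_
    rw [← C_pow, mul_right_comm, ← C_mul, ← pow_mul, mul_assoc ((tayl P i).coeff j), ← pow_add,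
      add_comm (2 * j) i]
  -- split off the two special terms `(i, j) = (0, 0), (1, 0)`
  set T : ℕ → ℕ → Polynomial (Rt P)[X] := fun i j =>
    C (C ((tayl P i).coeff j * rhoR P d ^ (i + 2 * j)) * X ^ j) * X ^ i with hT
  have h5 : ∀ i j, T i j = (if (i = 0 ∧ j = 0) ∨ (i = 1 ∧ j = 0) then T i j else 0) +
      C (C (rhoR P d ^ 2)) * (if (i = 0 ∧ j = 0) ∨ (i = 1 ∧ j = 0) then 0
        else C (C ((tayl P i).coeff j * rhoR P d ^ (i + 2 * j - 2)) * X ^ j) * X ^ i) := by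
    intro i j
    split_ifs with hij
    · rw [mul_zero, add_zero]
    · rw [zero_add, hT]
      dsimp only
      have hij2 : 2 ≤ i + 2 * j := by omega
      rw [← mul_assoc, ← C_mul, ← mul_assoc, ← C_mul, mul_comm (rhoR P d ^ 2), mul_assoc,
        ← pow_add, Nat.sub_add_cancel hij2]
  have h6 : ∑ i ∈ Finset.range (d + 1), ∑ j ∈ Finset.range (e + 1),
      (if (i = 0 ∧ j = 0) ∨ (i = 1 ∧ j = 0) then T i j else 0) = T 0 0 + T 1 0 := by
    have hd1 : 1 ∈ Finset.range (d + 1) := Finset.mem_range.2 (by omega)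
    have hd0 : 0 ∈ Finset.range (d + 1) := Finset.mem_range.2 (by omega)
    have he0 : 0 ∈ Finset.range (e + 1) := Finset.mem_range.2 (by omega)
    rw [Finset.sum_eq_add_sum_sdiff_singleton_of_mem hd0, Finset.sum_eq_single_of_mem 1
      (Finset.mem_sdiff.2 ⟨hd1, by simp⟩)]
    · rw [Finset.sum_eq_single_of_mem 0 he0, Finset.sum_eq_single_of_mem 0 he0]
      · simp
      · intro j _ hj; simp [hj]
      · intro j _ hj; simp [hj]
    · intro i hi hi1
      rw [Finset.mem_sdiff, Finset.mem_singleton] at hi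
      refine Finset.sum_eq_zero fun j _ => ?_
      rw [if_neg]
      rintro (⟨rfl, -⟩ | ⟨rfl, -⟩)
      · exact hi.2 rfl
      · exact hi1 rfl
  have h7 : T 0 0 = 0 := by
    rw [hT]; dsimp only; rw [tayl_zero_coeff_zero, zero_mul, map_zero, zero_mul, map_zero, zero_mul]
  have h8 : T 1 0 = C (C (rhoR P d * der0 P)) * X := by
    rw [hT]; dsimp only
    rw [tayl_one_coeff_zero, show 1 + 2 * 0 = 1 from rfl, pow_one, pow_zero, mul_one, pow_one,
      mul_comm (der0 P)]
  calc tildeP P d = ∑ i ∈ Finset.range (d + 1), ∑ j ∈ Finset.range (e + 1), T i j := h4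
    _ = (∑ i ∈ Finset.range (d + 1), ∑ j ∈ Finset.range (e + 1),
          (if (i = 0 ∧ j = 0) ∨ (i = 1 ∧ j = 0) then T i j else 0)) +
        C (C (rhoR P d ^ 2)) * bigG P d e := by
      rw [bigG, Finset.mul_sum, ← Finset.sum_add_distrib]
      refine Finset.sum_congr rfl fun i _ => ?_
      rw [Finset.mul_sum, ← Finset.sum_add_distrib]
      exact Finset.sum_congr rfl fun j _ => h5 i j
    _ = C (C (rhoR P d * der0 P)) * X + C (C (rhoR P d ^ 2)) * bigG P d e := by rw [h6, h7, h8, zero_add]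
    _ = C (C (rhoR P d * der0 P)) * natF P d e := by
      rw [natF, mul_add, ← mul_assoc, ← C_mul, ← C_mul, sq, mul_assoc (rhoR P d) (der0 P),
        mul_comm (der0 P) (cof P d), cof_mul_derivative hd (natDegree_map_le.trans hP)]

end Taylor

/-! ### Newton iteration from `u = 0` with unit derivative -/

section Newton

variable {B : Type v} [CommRing B]

/-- `a₀ = 0`. [folklore] -/
@[simp] theorem newtonSeq_zero (χ : Polynomial B[X]) : newtonSeq χ 0 = 0 := rfl

/-- `a_{k+1} = a_k - χ(a_k)`. [folklore] -/
theorem newtonSeq_succ (χ : Polynomial B[X]) (k : ℕ) :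
    newtonSeq χ (k + 1) = newtonSeq χ k - χ.eval (newtonSeq χ k) := rfl

/-- Newton iterates are functorial in the coefficient ring. [folklore] -/
theorem map_newtonSeq {B' : Type*} [CommRing B'] (φ : B →+* B') (χ : Polynomial B[X]) (k : ℕ) :
    (newtonSeq χ k).map φ = newtonSeq (χ.map (mapRingHom φ)) k := by
  induction k with
  | zero => simp
  | succ k ih =>
    rw [newtonSeq_succ, newtonSeq_succ, Polynomial.map_sub, ← coe_mapRingHom, ← eval_map_apply,
      coe_mapRingHom, ih]

/-- **Newton–Hensel lifting, explicit form:** if `Y ∣ χ(0)` and `Y ∣ 1 - χ'(0)` then the `k`-th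
iterate is `≡ 0 (mod Y)` and is a root of `χ` to precision `Y^{k+1}`. [cite: Kaltofen1995, §2 Step N] -/
theorem newtonSeq_spec (χ : Polynomial B[X]) (h0 : (X : B[X]) ∣ χ.eval 0)
    (h1 : (X : B[X]) ∣ 1 - (derivative χ).eval 0) (k : ℕ) :
    (X : B[X]) ∣ newtonSeq χ k ∧ (X : B[X]) ^ (k + 1) ∣ χ.eval (newtonSeq χ k) := by
  induction k with
  | zero => exact ⟨dvd_zero _, by simpa using h0⟩
  | succ k ih =>
    obtain ⟨hmod, hk⟩ := ih
    have hχ : (X : B[X]) ∣ χ.eval (newtonSeq χ k) := (dvd_pow_self _ (Nat.succ_ne_zero k)).trans hk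
    refine ⟨?_, ?_⟩
    · rw [newtonSeq_succ]
      exact dvd_sub hmod hχ
    · -- transfer the derivative condition from `0` to `a_k ≡ 0`
      have hu : (X : B[X]) ∣ 1 - 1 * (derivative χ).eval (newtonSeq χ k) := by
        have h2 : (X : B[X]) ∣ (derivative χ).eval (newtonSeq χ k) - (derivative χ).eval 0 := by
          have := Literature.NumberTheory.DiophantineGeometry.dvd_eval_sub_eval
            (d := (X : B[X])) (a := newtonSeq χ k) (b := 0) (by simpa using hmod) (derivative χ)
          exact this
        have : 1 - 1 * (derivative χ).eval (newtonSeq χ k) =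
            (1 - (derivative χ).eval 0) - ((derivative χ).eval (newtonSeq χ k) -
              (derivative χ).eval 0) := by ring
        rw [this]
        exact dvd_sub h1 h2
      have := Literature.NumberTheory.DiophantineGeometry.newton_step χ 1 (by omega) hk hu
      rwa [one_mul, ← newtonSeq_succ] at this

end Newton

/-! ### The truncated scaled root `δ̄` and the root property of `α♯ = z̄ + ρ δ̄` -/

section Root

variable (P : Polynomial A[X]) (d e : ℕ)

/-- `Y ∣ G(0, Y)`. [folklore] -/
theorem X_dvd_eval_zero_bigG : (X : (Rt P)[X]) ∣ (bigG P d e).eval 0 := by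
  rw [bigG, eval_finsetSum]
  refine Finset.dvd_sum fun i _ => ?_
  rw [eval_finsetSum]
  refine Finset.dvd_sum fun j _ => ?_
  split_ifs with hij
  · simp
  · rw [eval_mul, eval_C, eval_pow, eval_X]
    rcases Nat.eq_zero_or_pos i with rfl | hi
    · have hj : j ≠ 0 := fun hj => hij (Or.inl ⟨rfl, hj⟩)
      rw [pow_zero, mul_one]
      exact Dvd.dvd.mul_left (dvd_pow_self _ hj) _
    · rw [zero_pow hi.ne', mul_zero]
      exact dvd_zero _

/-- `Y ∣ ∂G/∂u (0, Y)`. [folklore] -/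
theorem X_dvd_eval_zero_derivative_bigG :
    (X : (Rt P)[X]) ∣ (derivative (bigG P d e)).eval 0 := by
  rw [bigG, derivative_sum, eval_finsetSum]
  refine Finset.dvd_sum fun i _ => ?_
  rw [derivative_sum, eval_finsetSum]
  refine Finset.dvd_sum fun j _ => ?_
  split_ifs with hij
  · simp
  · rw [derivative_C_mul_X_pow, eval_mul, eval_C, eval_pow, eval_X]
    rcases Nat.lt_trichotomy i 1 with hi | rfl | hi
    · have : i = 0 := by omega
      subst this
      simp
    · have hj : j ≠ 0 := fun hj => hij (Or.inr ⟨rfl, hj⟩)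
      rw [Nat.sub_self, pow_zero, mul_one, Nat.cast_one, mul_one]
      exact Dvd.dvd.mul_left (dvd_pow_self _ hj) _
    · rw [zero_pow (by omega), mul_zero]
      exact dvd_zero _

/-- `δ̄ ≡ 0 (mod Y)` and `F♮(δ̄) ≡ 0 (mod Y^{K+1})`. [cite: Kaltofen1995, §2 Step N] -/
theorem deltaBar_spec (K : ℕ) :
    (X : (Rt P)[X]) ∣ deltaBar P d e K ∧
      (X : (Rt P)[X]) ^ (K + 1) ∣ (natF P d e).eval (deltaBar P d e K) := by
  refine newtonSeq_spec _ ?_ ?_ K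
  · rw [natF, eval_add, eval_X, zero_add, eval_mul, eval_C]
    exact Dvd.dvd.mul_left (X_dvd_eval_zero_bigG P d e) _
  · rw [natF, derivative_add, derivative_X, derivative_mul, derivative_C, zero_mul, zero_add,
      eval_add, eval_one, eval_mul, eval_C, sub_add_cancel_left, dvd_neg]
    exact Dvd.dvd.mul_left (X_dvd_eval_zero_derivative_bigG P d e) _

/-- **Root property of the scaled Newton root:** `P(α♯_K, ρ²Y) ≡ 0 (mod Y^{K+1})` in `R[Y]`
(`deg_x P ≤ d`, `d ≥ 1`, `deg_y P ≤ e`). [cite: Kaltofen1995, §2 Step N, §3 Thm. 1] -/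
theorem X_pow_dvd_eval_sharpP_alphaSharp (hd : d ≠ 0) (hP : P.natDegree ≤ d)
    (hPe : ∀ k, (P.coeff k).natDegree ≤ e) (K : ℕ) :
    (X : (Rt P)[X]) ^ (K + 1) ∣ (sharpP P d).eval (alphaSharp P d e K) := by
  have h := congrArg (fun Q => Q.eval (deltaBar P d e K)) (tildeP_eq hd hP hPe)
  simp only [tildeP, eval_comp, eval_add, eval_mul, eval_C, eval_X] at h
  rw [alphaSharp, h]
  exact Dvd.dvd.mul_left (deltaBar_spec P d e K).2 _

end Root

end Literature.RingTheory.MvPolynomial.KaltofenAIT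

end
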